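import Summits.QuantumAdvantage.AdviceFreeQNC0.AffBells28SubDoubleCount
import Summits.QuantumAdvantage.AdviceFreeQNC0.AffBells28Assembly
import Summits.QuantumAdvantage.AdviceFreeQNC0.AffBells28Leaf
import Summits.QuantumAdvantage.AdviceFreeQNC0.KernelFibrationMoves
import HarnessLib

/-!
# Sketch29 v3, part 1/5 (planner qn-p1 g29, ROUND-28): §29.1 absolute peeling (`absPeel`, PROVED), §29.2 the list bookkeeping and `peelList` (PROVED), §29.3 the class-free CUBE WITNESS `CubeWitness`, `Refuting`, `isoRefutes_iff`, `cubeRefutes` (PROVED)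

(VERBATIM slice of `HOME/qa-qnc0-p1/exp29/Sketch29.lean` (sha16 `d7934601fa3f468f`, 1191 l., farm rc 0 / 0 sorry / 0 warnings), authored AND
proved by the planner seat qn-p1 g29; landed by the prover seat qn-prover-3 g14 (ask P-29b) as five files (400-line rule).  Changes: file
boundaries with per-file preamble, one-line docstrings on undocumented auxiliaries (lint), and in part 1 the planner's re-proofs
`AffBells29.peeling/peelingList` are omitted in favour of the landed `AffBells28.peeling/peelingList` (gate dedup), as the ask allows.)
WHAT THIS IS NOT: `HClassA` (the one remaining c-free conjecture of the (NP₁) plan) is NOT touched; separation NOT moved.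
-/

namespace Summit.QuantumAdvantage.AdviceFreeQNC0

namespace AffBells29

open Finset Literature.Computability.QuantumComplexity Literature.Computability.QuantumComplexity.RingHLF
open AffBells23 AffBells26 Fib19 AffBells27 AffBells28

variable {N : ℕ}

/-! ### §29.1 Absolute peeling (PROVED)

The one computation behind every certificate of the programme: flipping the coin pair `{i,j}` from a point `x₁` changes the form of row `g` by
`dPair β x₁ g i j`, hence (three-term identity) `fires c R (flip x₁) + fires c R x₁ ≡ |R'| + fires (c + d) R' x₁ (mod 2)`, `R'` = rows of `R`
seeing the flip.  If the XOR of the tests of `R` is constant on the sub-fibre, the right-hand side is `≡ 0`: an ABSOLUTE parity, not just a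
constancy one level down. -/

/-- The form after a pair flip. -/
theorem form_flipAt_pair (β : Fin N → Fin N → ZMod 3) (x₁ : Fin N → Bool) (g : Fin N) {i j : Fin N} (hij : i ≠ j) :
    form β (flipAt x₁ {i, j}) g = form β x₁ g + dPair β x₁ g i j := by
  unfold form dPair
  have key : ∀ k : Fin N, (if flipAt x₁ {i, j} k then β g k else 0) =
      (if x₁ k then β g k else 0) + ((if k = i then (if x₁ i then -β g i else β g i) else 0) +
        (if k = j then (if x₁ j then -β g j else β g j) else 0)) := by
    intro k
    by_cases hki : k = i
    · subst hki
      have hm : k ∈ ({k, j} : Finset (Fin N)) := by simp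
      rw [flipAt_apply_of_mem hm]
      cases hx : x₁ k <;> simp [hij]
    · by_cases hkj : k = j
      · subst hkj
        have hm : k ∈ ({i, k} : Finset (Fin N)) := by simp
        rw [flipAt_apply_of_mem hm]
        cases hx : x₁ k <;> simp [hki]
      · have hm : k ∉ ({i, j} : Finset (Fin N)) := by simp [hki, hkj]
        rw [flipAt_apply_of_not_mem hm]
        simp [hki, hkj]
  rw [sum_congr rfl fun k _ => key k, sum_add_distrib, sum_add_distrib, sum_ite_eq', sum_ite_eq']
  simp

/-- The parity bookkeeping of one pair flip (no hypothesis): `fires c R (flipAt x₁ {i,j}) + fires c R x₁ ≡ |R'| + fires (c+d) R' x₁ (mod 2)`. -/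
theorem fires_flip_pair (β : Fin N → Fin N → ZMod 3) (c : Fin N → ZMod 3) (R : Finset (Fin N)) (x₁ : Fin N → Bool)
    {i j : Fin N} (hij : i ≠ j) :
    (fires β c R (flipAt x₁ {i, j}) + fires β c R x₁) % 2 =
      ((R.filter fun g => dPair β x₁ g i j ≠ 0).card +
        fires β (fun g => c g + dPair β x₁ g i j) (R.filter fun g => dPair β x₁ g i j ≠ 0) x₁) % 2 := by
  unfold fires
  rw [filter_filter, card_eq_sum_ones, card_eq_sum_ones, card_eq_sum_ones, card_eq_sum_ones, sum_filter, sum_filter, sum_filter,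
    sum_filter, ← sum_add_distrib, ← sum_add_distrib]
  conv_lhs => rw [Finset.sum_nat_mod]
  conv_rhs => rw [Finset.sum_nat_mod]
  congr 1
  refine sum_congr rfl fun g _ => ?_
  beta_reduce
  rw [form_flipAt_pair β x₁ g hij]
  generalize form β x₁ g = u
  generalize dPair β x₁ g i j = d
  generalize c g = e
  revert u d e
  decide

/- `AffBells29.subFibre_subset_of_mem` omitted: identical to the landed `AffBells28.subFibre_subset_of_mem` (AffBells28PeelingList.lean). -/

/-- A point lies in its own sub-fibre (if odd). -/
theorem self_mem_subFibre {x₁ : Fin N → Bool} (hodd : IsOdd x₁) (C : Finset (Fin N)) : x₁ ∈ SubFibre x₁ C := by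
  simp [SubFibre, hodd]

/-- Same kernel line, same coins. -/
theorem klineZeros_eq_of_kline {x x₁ : Fin N → Bool} (hk : kline x₁ = kline x) : klineZeros x₁ = klineZeros x := by
  unfold klineZeros
  rw [hk]

/-- Flipping two window coins stays in the sub-fibre. -/
theorem flipAt_pair_mem_subFibre (hN : 3 ≤ N) {x x₁ : Fin N → Bool} {C : Finset (Fin N)} (hC : C ⊆ klineZeros x)
    (hx₁ : x₁ ∈ SubFibre x C) {i j : Fin N} (hi : i ∈ C) (hj : j ∈ C) (hij : i ≠ j) :
    flipAt x₁ {i, j} ∈ SubFibre x C := by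
  have hx₁' := hx₁
  simp only [SubFibre, mem_filter, mem_univ, true_and] at hx₁' ⊢
  obtain ⟨hodd₁, hk₁, hoff₁⟩ := hx₁'
  have hzi : kline x₁ i = false := by rw [hk₁]; exact (mem_filter.1 (hC hi)).2
  have hzj : kline x₁ j = false := by rw [hk₁]; exact (mem_filter.1 (hC hj)).2
  obtain ⟨hodd', hk'⟩ := kline_flipPair hN x₁ hodd₁ hij hzi hzj
  refine ⟨hodd', hk'.trans hk₁, fun k hk => ?_⟩
  have hkm : k ∉ ({i, j} : Finset (Fin N)) := by
    simp only [mem_insert, mem_singleton, not_or]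
    exact ⟨fun h => hk (h ▸ hi), fun h => hk (h ▸ hj)⟩
  rw [flipAt_apply_of_not_mem hkm]
  exact hoff₁ k hk

/-- **ABSOLUTE PEEL (PROVED).** If the XOR of the tests of `R` (offsets `c`) is constant on `SubFibre x C`, then at every point `x₁` of it and
for all coins `i ≠ j` of `C`: the number of rows of `R` that SEE the flip of `{i,j}` from `x₁` and fire under the shifted offsets `c + dPair`
has the parity of the number of rows that see the flip. -/
theorem absPeel (hN : 3 ≤ N) (β : Fin N → Fin N → ZMod 3) (c : Fin N → ZMod 3) (R : Finset (Fin N)) {x : Fin N → Bool}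
    {C : Finset (Fin N)} (hC : C ⊆ klineZeros x) (hS : SysConst β c R x C) {x₁ : Fin N → Bool} (hx₁ : x₁ ∈ SubFibre x C)
    {i j : Fin N} (hi : i ∈ C) (hj : j ∈ C) (hij : i ≠ j) :
    fires β (fun g => c g + dPair β x₁ g i j) (R.filter fun g => dPair β x₁ g i j ≠ 0) x₁ % 2 =
      (R.filter fun g => dPair β x₁ g i j ≠ 0).card % 2 := by
  have h1 := hS _ (flipAt_pair_mem_subFibre hN hC hx₁ hi hj hij) _ hx₁
  have h2 := fires_flip_pair β c R x₁ hij
  omega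

/-- `dPair` depends on the base point only through the pattern on `{i, j}`. -/
theorem dPair_congr (β : Fin N → Fin N → ZMod 3) {x' x₁ : Fin N → Bool} {i j : Fin N} (hi : x' i = x₁ i) (hj : x' j = x₁ j)
    (g : Fin N) : dPair β x' g i j = dPair β x₁ g i j := by
  unfold dPair
  rw [hi, hj]

/-! ### §29.2 `Peeling` and `PeelingList` (Sketch28 §28.2, prover targets P-28a(i)(ii)) PROVED from the absolute peel -/

/- `AffBells29.peeling : Peeling` (Sketch29 §29.2) omitted by the lander: it is the landed `AffBells28.peeling` (AffBells28Peeling.lean, p653112). -/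

/-- Unfolding `MovesIn` along a cons. -/
theorem movesIn_cons {C₀ : Finset (Fin N)} {p : Fin N × Fin N} {L : List (Fin N × Fin N)} (h : MovesIn C₀ (p :: L)) :
    p.1 ∈ C₀ ∧ p.2 ∈ C₀ ∧ p.1 ≠ p.2 ∧ p.1 ∉ moveCoins L ∧ p.2 ∉ moveCoins L ∧ MovesIn C₀ L := by
  obtain ⟨hmem, hnd⟩ := h
  simp only [List.map_cons, List.cons_append] at hnd
  rw [List.nodup_cons, List.nodup_middle, List.nodup_cons] at hnd
  obtain ⟨h1, h2, h3⟩ := hnd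
  simp only [List.mem_append, List.mem_cons, not_or] at h1 h2
  refine ⟨(hmem p (by simp)).1, (hmem p (by simp)).2, h1.2.1, ?_, ?_, fun q hq => hmem q (by simp [hq]), h3⟩
  · simp only [moveCoins, List.mem_toFinset, List.mem_append, not_or]; exact ⟨h1.1, h1.2.2⟩
  · simp only [moveCoins, List.mem_toFinset, List.mem_append, not_or]; exact h2

/- `AffBells29.surv_cons` omitted: identical to the landed `AffBells28.surv_cons` (AffBells28PeelingList.lean). -/

/- `AffBells29.cShift_cons` omitted: identical to the landed `AffBells28.cShift_cons` (AffBells28PeelingList.lean). -/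

/- `AffBells29.sdiff_moveCoins_cons` omitted: identical to the landed `AffBells28.sdiff_moveCoins_cons` (AffBells28PeelingList.lean). -/

/-- **PEELING ALONG A LIST, absolute form (PROVED).** Under `SysConst β c (act x) x C₀`, at a point `x₁` of the sub-fibre and along disjoint
pair moves `L` inside `C₀`: (i) the shifted XOR of the survivors is constant on `SubFibre x₁ (C₀ ∖ moveCoins L)` (= `PeelingList`), and
(ii) if `L ≠ []`, the number of survivors firing under the shifted offsets AT `x₁` has the parity of the number of survivors. -/
theorem peelList (hN : 3 ≤ N) (β : Fin N → Fin N → ZMod 3) (c : Fin N → ZMod 3) {x : Fin N → Bool} {C₀ : Finset (Fin N)}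
    (hC₀ : C₀ ⊆ klineZeros x) (hS : SysConst β c (act x) x C₀) {x₁ : Fin N → Bool} (hx₁ : x₁ ∈ SubFibre x C₀) :
    ∀ L : List (Fin N × Fin N), MovesIn C₀ L →
      SysConst β (cShift β c x₁ L) (surv β x x₁ L) x₁ (C₀ \ moveCoins L) ∧
        (L ≠ [] → fires β (cShift β c x₁ L) (surv β x x₁ L) x₁ % 2 = (surv β x x₁ L).card % 2) := by
  have hx₁' := hx₁
  simp only [SubFibre, mem_filter, mem_univ, true_and] at hx₁'
  obtain ⟨hodd₁, hk₁, -⟩ := hx₁'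
  have hCz : C₀ ⊆ klineZeros x₁ := by rw [klineZeros_eq_of_kline hk₁]; exact hC₀
  intro L
  induction L with
  | nil =>
    intro _
    refine ⟨?_, fun h => (h rfl).elim⟩
    have h0 : moveCoins ([] : List (Fin N × Fin N)) = ∅ := by simp [moveCoins]
    rw [h0, sdiff_empty]
    intro x' hx' x'' hx''
    have e1 : cShift β c x₁ [] = c := by funext g; simp [cShift]
    have e2 : surv β x x₁ [] = act x := by simp [surv]
    rw [e1, e2]
    exact hS x' (subFibre_subset_of_mem hx₁ hx') x'' (subFibre_subset_of_mem hx₁ hx'')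
  | cons p L ih =>
    intro hM
    obtain ⟨hp1, hp2, hne, hn1, hn2, hM'⟩ := movesIn_cons hM
    obtain ⟨ihS, -⟩ := ih hM'
    have hi : p.1 ∈ C₀ \ moveCoins L := mem_sdiff.2 ⟨hp1, hn1⟩
    have hj : p.2 ∈ C₀ \ moveCoins L := mem_sdiff.2 ⟨hp2, hn2⟩
    have hsub : C₀ \ moveCoins L ⊆ klineZeros x₁ := sdiff_subset.trans hCz
    rw [surv_cons, cShift_cons, sdiff_moveCoins_cons]
    refine ⟨?_, fun _ => ?_⟩
    · exact peeling N hN β (cShift β c x₁ L) (surv β x x₁ L) x₁ (C₀ \ moveCoins L) hodd₁ hsub ihS x₁ (self_mem_subFibre hodd₁ _)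
        p.1 hi p.2 hj hne
    · exact absPeel hN β (cShift β c x₁ L) (surv β x x₁ L) hsub ihS (self_mem_subFibre hodd₁ _) hi hj hne

/- `AffBells29.peelingList : PeelingList` omitted likewise: landed as `AffBells28.peelingList` (AffBells28PeelingList.lean, p653762). -/

/-! ### §29.3 The CLASS-FREE CUBE WITNESS (decidable) and its refutation property (PROVED)

A cube witness at the window `(x, C₀)` is a point `x₁` of the sub-fibre and a NONEMPTY list of disjoint pair moves inside `C₀` such that the
number of survivors (active rows seeing every move) firing under the fully shifted offsets at `x₁` has parity DIFFERENT from the number of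
survivors.  Equivalently (telescoping the absolute peel): the win/test-XOR summed over the `2^{|L|}` points `x₁ ⊕ (moves of a sub-list)` is ODD,
so the sub-fibre is MIXED.  No classes, no leaf forms, no readers: `Leaf` (Sketch28 §28.3) is not needed on this route. -/

/-- **CUBE WITNESS** for `(β, c)` at the window `(x, C₀)`. -/
def CubeWitness (β : Fin N → Fin N → ZMod 3) (c : Fin N → ZMod 3) (x : Fin N → Bool) (C₀ : Finset (Fin N)) : Prop :=
  ∃ x₁ ∈ SubFibre x C₀, ∃ L : List (Fin N × Fin N), L ≠ [] ∧ MovesIn C₀ L ∧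
    fires β (cShift β c x₁ L) (surv β x x₁ L) x₁ % 2 ≠ (surv β x x₁ L).card % 2

/-- A window-certificate predicate `W` is REFUTING if a certified window has a lost point in its sub-fibre (`IsoRefutes` is this for `IsoWitness`). -/
def Refuting (W : ∀ {N : ℕ}, (Fin N → Fin N → ZMod 3) → (Fin N → ZMod 3) → (Fin N → Bool) → Finset (Fin N) → Prop) : Prop :=
  ∀ N : ℕ, 3 ≤ N → ∀ (β : Fin N → Fin N → ZMod 3) (c : Fin N → ZMod 3) (x : Fin N → Bool) (C₀ : Finset (Fin N)),
    IsOdd x → C₀ ⊆ klineZeros x → W β c x C₀ → ∃ x' ∈ SubFibre x C₀, ¬ RingHLF.Rel x' (affBell β c x')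

/-- `IsoRefutes` is `Refuting IsoWitness` (definitional). -/
theorem isoRefutes_iff : IsoRefutes ↔ Refuting @IsoWitness := Iff.rfl

/-- **CUBE WITNESSES REFUTE (PROVED, unconditional):** a cube witness at `(x, C₀)` forces a lost point in `SubFibre x C₀`. -/
theorem cubeRefutes : Refuting @CubeWitness := by
  intro N hN β c x C₀ _ hC₀ ⟨x₁, hx₁, L, hL0, hL, hne⟩
  by_contra hcon
  simp only [not_exists, not_and, not_not] at hcon
  have hall : AllWin β c x C₀ := fun y hy => hcon y hy
  exact hne ((peelList hN β c hC₀ (subFibreBridge hN β c x C₀ hall) hx₁ L hL).2 hL0)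

end AffBells29

end Summit.QuantumAdvantage.AdviceFreeQNC0
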